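import Summits.CriticalPhenomena.SAWScalingLimit.Theses.SAWDefectDecoherence

/-!
# Sketch — crux-ideate round 2, ideator 5 (gen 2), crux `MassRatio` (stmt-CriticalPhenomena-8550)

Card `symmetrised-synthesis-laplacian-defect` (planner-level lever).

* `starDefect` — the full vertex-star defect `T(v) = Σ_{t ∼ v} conj(mid{v,t} − c_v) · F_{x,σ}({v,t})`
  (all three neighbours; for an `R`-deep vertex this is the sum in `DefectDecoherence`).
* `symmetrised_regrouping` — the EXACT two-colour regrouping identity (finite bookkeeping, provable
  now, toy-verified to 1e-15): `Σ_{v ∈ S} ε(v) φ(v) T(v) = Σ_{(b,w), b black} (φ1_S(b) + φ1_S(w)) ·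
  conj(mid − c_b) · F({b,w})`, because `mid − c_w = −(mid − c_b)`.
* `laplacianDefect` / `LaplacianDefectDecoherence θ₂` — the NEW item the re-cut needs:
  `D(b) = T(b) − (1/3) Σ_{w ∼ b} T(w)` bounded by `C R^{-θ₂} ×` (cluster mass), predicted
  `θ₂ = 2 + 25/48`.
* `MassRatioAt c` — the crux at a general cut (verbatim from `Lines/coherence-floor-rh-harnack.lean`;
  `MassRatio` is `MassRatioAt (3/4)`).
* `ConjugateClassNegligibleC2` — the node for `C²` test functions.
* `synthesis_at_cut` — the new glue (statement; M-sized for a prover):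
  `BoundaryWindingRigidity → LaplacianDefectDecoherence θ₂ → MassRatioAt c → c < 2 → c < θ₂ →
   ConjugateClassNegligibleC2`.
-/

namespace Summit.CriticalPhenomena.SAWScalingLimit.Cruxes.MassRatio.SymmetrisedSynthesis

open Literature.Probability.LatticeModels Literature.Probability.RandomPlanarGeometry
open Literature.Probability.RandomPlanarGeometry.SAW
open Summit.CriticalPhenomena.SAWScalingLimit.Theses.SAWDefectDecoherence

noncomputable section

/-- Colour sign `ε(v)`: `+1` on black vertices (`v.2 = 0`), `−1` on white ones. -/
def colourSign (v : HexVertex) : ℂ := if v.2 = 0 then 1 else -1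

/-- The full vertex-star defect `T(v) = Σ_{t ∼ v} conj(mid{v,t} − c_v) · F_{x,σ}({v,t})`
(all three lattice neighbours of `v`). -/
def starDefect (Λ : Finset HexVertex) (a : Sym2 HexVertex) (x σ : ℝ) (v : HexVertex) : ℂ :=
  ∑ᶠ t ∈ {t : HexVertex | hexGraph.Adj v t},
    (starRingEnd ℂ) (hexMidpoint s(v, t) - hexCenter v) * hexParafermionicObservable Λ a x σ s(v, t)

/-- The Laplacian (two-colour) defect at a vertex `v` (intended black):
`D(v) = T(v) − (1/3) Σ_{w ∼ v} T(w)`. -/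
def laplacianDefect (Λ : Finset HexVertex) (a : Sym2 HexVertex) (x σ : ℝ) (v : HexVertex) : ℂ :=
  starDefect Λ a x σ v - (1 / 3 : ℂ) * ∑ᶠ w ∈ {w : HexVertex | hexGraph.Adj v w}, starDefect Λ a x σ w

/-- **First lemma (exact, provable now).** Two-colour regrouping of the star defects: for every
finite vertex set `S` and weight `φ`, the signed sum `Σ_{v ∈ S} ε(v) φ(v) T(v)` equals the sum over
lattice edges `{b, w}` (`b` black) touching `S` of `(φ1_S(b) + φ1_S(w)) · conj(mid − c_b) · F({b,w})`,
since `mid{b,w} − c_w = −(mid{b,w} − c_b)` (`hexMidpoint_mk`) and the honeycomb is bipartite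
(`not_hexGraph_adj_of_snd_eq`). With `φ = ψ(δ c_·)` this is the identity behind the symmetrised
synthesis: the node's sum `Σ_e ψ(δ·mid e) conj(c_w − c_b) F(e)` equals
`Σ_b φ T(b) − Σ_w φ T(w) + Σ_e [2ψ(δ mid) − φ(b) − φ(w)] conj(mid − c_b) F(e)`,
and the last bracket is a midpoint SECOND difference, `O(δ²‖ψ‖_{C²})`. -/
theorem symmetrised_regrouping (Λ : Finset HexVertex) (a : Sym2 HexVertex) (x σ : ℝ)
    (S : Finset HexVertex) (φ : HexVertex → ℂ) :
    ∑ v ∈ S, colourSign v * φ v * starDefect Λ a x σ v =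
      ∑ᶠ p ∈ {p : HexVertex × HexVertex | hexGraph.Adj p.1 p.2 ∧ p.1.2 = 0 ∧ (p.1 ∈ S ∨ p.2 ∈ S)},
        ((if p.1 ∈ S then φ p.1 else 0) + (if p.2 ∈ S then φ p.2 else 0)) *
          ((starRingEnd ℂ) (hexMidpoint s(p.1, p.2) - hexCenter p.1) *
            hexParafermionicObservable Λ a x σ s(p.1, p.2)) := by
  sorry

/-- **NEW ITEM (for the tenure planner) — Laplacian defect decoherence at exponent `θ₂`.**
Universal `C` such that for every simply connected hexagonal domain `Λ`, boundary root
`a = {u, w}` (`u ∉ Λ ∋ w`), black vertex `v` that is `R`-deep (`R ≥ 2`):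
`|T(v) − (1/3) Σ_{w ∼ v} T(w)| ≤ C R^{-θ₂} · Σ_{t ∼ v} (Z({v,t}) + Σ_{s ∼ t} Z({t,s}))`
(cluster mass of the star of `v` and the three neighbouring stars; `Z = F_{x_c,0}`,
`T = starDefect … (5/8)`). Predicted `θ₂ = 2 + 25/48`: `T(b)` and `T(w)` share the leading
sublattice-gradient term `(3ℓ²/4) ∂f · F(b_δ)` of the smooth expansion (same sign on both colours),
which the Laplacian combination removes; what is left is the second-order smooth term
(`∝ ∂̄²f`, zero for holomorphic `f`) and genuine class structure (Coulomb-gas alias `n = −2`,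
stability index `3/2`), both at `2 + 25/48` against the mass. Needed after the re-cut: `θ₂ > c`. -/
def LaplacianDefectDecoherence (θ₂ : ℝ) : Prop :=
  ∃ C : ℝ, ∀ (Λ : Finset HexVertex), hexDomainSimplyConnected Λ →
    ∀ (u w : HexVertex), hexGraph.Adj u w → u ∉ Λ → w ∈ Λ →
    ∀ (v : HexVertex) (R : ℝ), v.2 = 0 → 2 ≤ R →
      (∀ y : HexVertex, dist (hexCenter y) (hexCenter v) ≤ R → y ∈ Λ) →
      ‖laplacianDefect Λ s(u, w) hexCriticalFugacity (5 / 8) v‖ ≤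
        C * R ^ (-θ₂) * ∑ᶠ t ∈ {t : HexVertex | hexGraph.Adj v t},
          (‖hexParafermionicObservable Λ s(u, w) hexCriticalFugacity 0 s(v, t)‖ +
            ∑ᶠ s ∈ {s : HexVertex | hexGraph.Adj t s},
              ‖hexParafermionicObservable Λ s(u, w) hexCriticalFugacity 0 s(t, s)‖)

/-- `MassRatioAt c`: the crux with exponent cut `c` (`MassRatio` is `MassRatioAt (3/4)` up to the
spelling of `-(3:ℝ)/4` and its `let`); verbatim from `Lines/coherence-floor-rh-harnack.lean`. -/
def MassRatioAt (c : ℝ) : Prop :=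
  ∀ (D : DobrushinDomain) (ρ : ℝ) (Λ : ℝ → Finset HexVertex) (m : ℝ → ℤ)
    (a b : ℝ → Sym2 HexVertex),
    0 < ρ →
    D.carrier ∩ Metric.ball (D.pt 1) ρ = {z : ℂ | (D.pt 1).im < z.im} ∩ Metric.ball (D.pt 1) ρ →
    (∀ᶠ δ : ℝ in nhdsWithin 0 (Set.Ioi 0),
      hexDomainSimplyConnected (Λ δ) ∧ a δ ∈ hexDomainBoundary (Λ δ) ∧
        b δ ∈ hexDomainBoundary (Λ δ) ∧ Nonempty (HexMidEdgeSAW (Λ δ) (a δ) (b δ)) ∧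
        (hexGraph.induce ((Λ δ : Finset HexVertex) : Set HexVertex)).Preconnected ∧
        (∀ v ∈ Λ δ, (δ : ℂ) * hexCenter v ∈ D.carrier) ∧
        (∀ v : HexVertex, (δ : ℂ) * hexCenter v ∈ Metric.ball (D.pt 1) ρ →
          (v ∈ Λ δ ↔ m δ ≤ v.1 1))) →
    (∀ K : Set ℂ, IsCompact K → K ⊆ D.carrier → ∀ᶠ δ : ℝ in nhdsWithin 0 (Set.Ioi 0),
      ∀ v : HexVertex, (δ : ℂ) * hexCenter v ∈ K → v ∈ Λ δ) →
    Filter.Tendsto (fun δ : ℝ => (δ : ℂ) * hexMidpoint (a δ)) (nhdsWithin 0 (Set.Ioi 0))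
      (nhds (D.pt 0)) →
    Filter.Tendsto (fun δ : ℝ => (δ : ℂ) * hexMidpoint (b δ)) (nhdsWithin 0 (Set.Ioi 0))
      (nhds (D.pt 1)) →
    ∀ K : Set ℂ, IsCompact K → K ⊆ D.carrier → ∃ C : ℝ,
      ∀ᶠ δ : ℝ in nhdsWithin 0 (Set.Ioi 0),
        δ ^ 2 * (∑ᶠ e ∈ {e : Sym2 HexVertex | e ∈ hexDomainMidEdges (Λ δ) ∧
            (δ : ℂ) * hexMidpoint e ∈ K},
            ‖hexParafermionicObservable (Λ δ) (a δ) hexCriticalFugacity 0 e‖) ≤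
          C * δ ^ (-c) * ‖hexParafermionicObservable (Λ δ) (a δ) hexCriticalFugacity 0 (b δ)‖

/-- The node `ConjugateClassNegligible` for `C²` test functions (`ContDiff ℝ 2 ψ` instead of
`ContDiff ℝ 1 ψ`; otherwise verbatim): asymptotic weak `∂̄`-closure of `F_δ/F_δ(b_δ)`. -/
def ConjugateClassNegligibleC2 : Prop :=
  ∀ (D : Literature.Probability.RandomPlanarGeometry.DobrushinDomain) (ρ : ℝ) (Λ : ℝ → Finset Literature.Probability.LatticeModels.HexVertex) (m : ℝ → ℤ) (a b : ℝ → Sym2 Literature.Probability.LatticeModels.HexVertex) (ψ : ℂ → ℂ), let F : ℝ → Sym2 Literature.Probability.LatticeModels.HexVertex → ℂ := fun δ z => Literature.Probability.RandomPlanarGeometry.SAW.hexParafermionicObservable (Λ δ) (a δ) Literature.Probability.RandomPlanarGeometry.SAW.hexCriticalFugacity (5 / 8) z; 0 < ρ → D.carrier ∩ Metric.ball (D.pt 1) ρ = {z : ℂ | (D.pt 1).im < z.im} ∩ Metric.ball (D.pt 1) ρ → (∀ᶠ δ : ℝ in nhdsWithin 0 (Set.Ioi 0), Literature.Probability.RandomPlanarGeometry.SAW.hexDomainSimplyConnected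 (Λ δ) ∧ a δ ∈ Literature.Probability.RandomPlanarGeometry.SAW.hexDomainBoundary (Λ δ) ∧ b δ ∈ Literature.Probability.RandomPlanarGeometry.SAW.hexDomainBoundary (Λ δ) ∧ Nonempty (Literature.Probability.RandomPlanarGeometry.SAW.HexMidEdgeSAW (Λ δ) (a δ) (b δ)) ∧ (Literature.Probability.LatticeModels.hexGraph.induce ((Λ δ : Finset Literature.Probability.LatticeModels.HexVertex) : Set Literature.Probability.LatticeModels.HexVertex)).Preconnected ∧ (∀ v ∈ Λ δ, (δ : ℂ) * Literature.Probability.LatticeModels.hexCenter v ∈ D.carrier) ∧ (∀ v : Literature.Probability.LatticeModels.HexVertex, (δ : ℂ) * Literature.Probability.LatticeModels.hexCenter v ∈ Metric.ball (D.pt 1) ρ → (v ∈ Λ δ ↔ m δ ≤ v.1 1))) → (∀ K : Set ℂ, IsCompact K → K ⊆ D.carrier → ∀ᶠ δ : ℝ in nhdsWithin 0 (Set.Ioi 0), ∀ v : Literature.Probability.LatticeModels.HexVertex, (δ : ℂ) * Literature.Probability.LatticeModels.hexCenter v ∈ K → v ∈ Λ δ) → Filter.Tendsto (fun δ : ℝ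 => (δ : ℂ) * Literature.Probability.RandomPlanarGeometry.SAW.hexMidpoint (a δ)) (nhdsWithin 0 (Set.Ioi 0)) (nhds (D.pt 0)) → Filter.Tendsto (fun δ : ℝ => (δ : ℂ) * Literature.Probability.RandomPlanarGeometry.SAW.hexMidpoint (b δ)) (nhdsWithin 0 (Set.Ioi 0)) (nhds (D.pt 1)) → ContDiff ℝ 2 ψ → HasCompactSupport ψ → tsupport ψ ⊆ D.carrier → Filter.Tendsto (fun δ : ℝ => (δ : ℂ) ^ 2 * (∑ᶠ p ∈ {p : Literature.Probability.LatticeModels.HexVertex × Literature.Probability.LatticeModels.HexVertex | s(p.1, p.2) ∈ Literature.Probability.RandomPlanarGeometry.SAW.hexDomainMidEdges (Λ δ) ∧ p.1.2 = 0}, ψ ((δ : ℂ) * Literature.Probability.RandomPlanarGeometry.SAW.hexMidpoint s(p.1, p.2)) * (starRingEnd ℂ) (Literature.Probability.LatticeModels.hexCenter p.2 - Literature.Probability.LatticeModels.hexCenter p.1) * F δ s(p.1, p.2)) / F δ (b δ)) (nhdsWithin 0 (Set.Ioi 0)) (nhds 0)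

/-- **The new glue (statement; M-sized for a prover).** Symmetrised synthesis: with
`symmetrised_regrouping` (`φ = ψ(δ c_·)`), the midpoint second difference
`2ψ(δ mid) − ψ(δ c_b) − ψ(δ c_w) = O(δ²)`, the centroid identity `c_w = (1/3) Σ_{b ∼ w} c_b`
(so `ψ(δc_w) − (1/3)Σ_{b∼w} ψ(δ c_b) = O(δ²)`), the trivial bound `|T(w)| ≤ (1/(2√3)) Σ_{t∼w} Z({w,t})`,
`Z_δ(b_δ) = |F_δ(b_δ)|` (winding rigidity) and exhaustion, one gets
`δ² |S_ψ| / |F_δ(b_δ)| ≤ C (δ^{θ₂ − c} + δ^{2 − c})`; hence the node for every cut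
`c < min(θ₂, 2)`. (The first-order Taylor step of `DecoherenceSynthesis`, which forced `c < 1`,
and the single-star bound, which capped `θ ≤ 1 + 25/48`, are both gone.) -/
theorem synthesis_at_cut {θ₂ c : ℝ} (hc2 : c < 2) (hcθ : c < θ₂)
    (hBWR : BoundaryWindingRigidity) (hL : LaplacianDefectDecoherence θ₂) (hM : MassRatioAt c) :
    ConjugateClassNegligibleC2 := by
  sorry

/-- Sanity: the crux as filed is the cut `3/4` (the two spellings of the exponent agree). -/
theorem rpow_neg_three_quarters (δ : ℝ) : δ ^ (-(3 : ℝ) / 4) = δ ^ (-(3 / 4 : ℝ)) := by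
  norm_num

end

end Summit.CriticalPhenomena.SAWScalingLimit.Cruxes.MassRatio.SymmetrisedSynthesis
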